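import Summits.QuantumFields.YangMills.Theorems.UnitScaleTiltProp7DescendJunction
import Summits.QuantumFields.YangMills.Theorems.UnitScaleTiltProp7CombGaugeIter
import Summits.QuantumFields.YangMills.Theorems.BalabanUVNodesN12FlatHierAxialRepr
import Summits.QuantumFields.YangMills.Theorems.BalabanUVNodesN12FlatFibreNullSpace
import Literature.MathematicalPhysics.QuantumFieldTheory.Balaban1983to89.Node00.AveragingSmooth
import HarnessLib

/-!
# THE FLAT FIBRE TANGENT OF THE `(K−J)`-FOLD AVERAGE OF RECORD LIES IN THE KERNEL OF ITS LINEARISATION — `D(D_{n,K})(1) = Q^{(K−n)}` in velocity form —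
# and HESS∘ AT THE FLAT DATUM MODULO {TRANSVERSALITY, SECOND-ORDER CHAIN RULE}
# (crux `FluctuationComparisonRegPrIntL`, stmt-QuantumFields-20520; registry v11.4 `Cruxes/FluctuationComparisonRegPrIntL/Lines/semiclassical_s2beta.lean` stub 2 «GAP♯∘»
# ⟸ {TUBE-REG∘, Thm 1 (8)} (✓`…S2BetaInterBlock.uniformFibreGapOrbit_of_tubeReg_of_thm1`); TUBE♭ ⟸ {POS∘, ISOL∘(δ)} (✓p792634); POS∘ ⟸ {HESS∘, chart rows} (px21 g18
# (T1) ✓p793318 `…S2BetaGrowthOfHessianPos`, (T2a)–(T2c)); nothing of the registry is edited)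

Cell `ym3-torus` (YM ladder rung R3 = continuum `SU(2)` Yang–Mills on the three-torus — a RUNG: NOT d = 4, NOT infinite volume, NOT a mass gap, NOT Clay).  Width seat
`ym3-torus-px16` g17; `--kind proof --supports stmt-QuantumFields-20520 --as helper`, count-neutral, DEFINITION-FREE (0 `def`, 0 `instance`, 0 `notation`, 0 `sorry`,
default heartbeats).  Pen «FLAT INHABITANT of the (T)-chain, brick 1» (★★OWNER g40 №238; px21 g18 22:49:09Z «NOT MINE — GO» and the named missing identification
«range `DΨ(0)` ⊆ ker `Q^{(K−J)}`, i.e. `D(descendTo)(1) = iterLin`»).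

WHY.  The (T)-chain reduces TUBE♭(V,U₀) to the per-datum Hessian letter HESS∘ «`∀ y ≠ 0, 0 < D²(A∘Ψ)(0) y y`» for a chart `Ψ y = D.Φ (V, σ y)` through `U₀` inside the
fibre of the `(K−J)`-fold (0.4) average `descendTo`.  At the FLAT datum `(V ≡ 1, U₀ ≡ 1)` the tree already knows (i) the flat second variation of the Wilson action is the curl
energy (lit ✓`Node00.deriv_deriv_wilsonAction4_expChart_one_eq_norm_sq`) and (ii) the NULL SPACE of that energy on `ker Q^{(k)}` is exactly the Lie algebra of the
centre-vanishing gauge transformations (✓`BalabanUVNodes.N12FlatFibreNullSpace.exists_centreGauge_of_plaq_eq_zero_of_iterLin_eq_zero`, k-fold, matrix-valued).  What was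
missing to read (ii) on a chart of the (0.4)-FIBRE OF RECORD is the identification of the fibre's tangent space at `1` with `ker Q^{(K−n)}` — the derivative of
`descendTo` at the flat field.  The tree holds it as a C^{1,1} ESTIMATE (✓`Prop7DescendJunction.norm_descendTo_sub_one_le_and_sub_lin_le`, [Balaban1985Averaging]
Prop. 4 (134)–(135): `‖D_{n,K}U(b) − 1 − Q^{(K−n)}(U − 1)(bondShift b)‖ ≤ C₁·m²`); this file turns it into the VELOCITY statement a chart consumer needs.

WHAT IS PROVED.
* §1 `deriv_eq_zero_of_norm_le_sq` — calculus letter: a function with a derivative at `0`, vanishing at `0` and `O(t²)` there, has derivative `0`.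
* §2 ★★ `iterLin_eq_zero_of_hasDerivAt_of_descendTo_eq_one` — for every recursion family `Q^{(·)}` of `linAvg` and every curve `γ` of `SU(N)` fields on run `K`'s finest
  lattice with matrix entries differentiable at `0` (velocity `Z`), `γ 0 = 1` and `D_{n,K}(γ t) = 1` near `0`: `Q^{(K−n)} Z = 0` on every height-`(K−n)` bond (the three
  smallness rows of the C^{1,1} letter hold near `t = 0` because `‖γ t − 1‖ = O(t)`; `Y ↦ Q^{(K−n)}Y(c)` is a continuous real-linear map by ✓`Prop7CombGauge.iterLin_add` and
  ✓`N12FlatHierAxialRepr.iterLin_smul`; `bondShift` is an `Equiv`); ★★ `iterLin_fderiv_eq_zero_of_descendTo_eq_one` — the chart form (`Ψ : Y → fields`, `HasFDerivAt` of the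
  matrix entries at `0`, `Ψ 0 = 1`, `D_{n,K}(Ψ y) = 1` near `0` ⟹ `Q^{(K−n)}(Ψ′ y) = 0`).
* §3 ★★ `hessPos_flat_of_transversal_of_chainRule` — the (T)-chain's HESS∘ letter AT THE FLAT DATUM from §2 + the N12 null space, MODULO two displayed letters of the chart:
  `hT` (first-order transversality to the centre-vanishing pure gauges + injectivity — the tube chart's rows, px21's (T2c) object) and `hCR` (the second-order chain rule at
  the critical point `1`: `D²(A∘Ψ)(0)yy = κ·Σ_p ‖curl (Ψ′y) p‖²`, `κ > 0` — for the exponential chart this is lit ✓`deriv_deriv_wilsonAction4_expChart_one_eq_norm_sq` with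
  `κ = 1∕N`; for a general C² chart it needs the log-chart reduction, NOT done here).
HONEST: calculus glue at the trivial background; `hT`, `hCR` displayed; HESS∘ at print's regular (non-flat) minimiser — [Balaban1985Variational] (142) ∕ uniformly
[Balaban1985BackgroundPropagators] Thm 3.11 — POS∘, ISOL∘(δ), TUBE-REG∘, GAP♯∘, EXW∘, S2β, crux 20520 NOT proved; no summit statement is proved by a helper; rung R3 =
SU(2) YM₃ on T³ — NOT d = 4, NOT infinite volume, NOT a mass gap, NOT Clay; the Yang–Mills mass gap is NOT proved.  Sorry-free, axioms standard.
References: T. Bałaban, CMP **98** (1985) 17–51 [Balaban1985Averaging] (Prop. 4 (134)–(135) p.38, (11) p.18); CMP **109** (1987) 249–301 [Balaban1987RG1] ((0.4), (0.11) p.253);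
CMP **102** (1985) 277–309 [Balaban1985Variational] ((4) p.278, (142) p.299, Sect. E p.300); CMP **122** (1989) 355–392 [Balaban1989LargeFieldII] ((1.9) p.358, p.359).
-/

noncomputable section

open Filter Topology Asymptotics
open scoped Matrix.Norms.L2Operator
open Literature.MathematicalPhysics.QuantumFieldTheory.Balaban1983to89
open T3ContinuumYM3Torus (T3Family)
open T3TiltDescent (descendTo)
open T3LevelShift (bondShift)
open ExpMeanLog (expMeanLogSU deltaSU deltaSU_pos)
open BlockAveragingEMLLinearised (linAvg)
open Summit.QuantumFields.YangMills.Theorems.Prop7DescendJunction (norm_descendTo_sub_one_le_and_sub_lin_le)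
open Summit.QuantumFields.YangMills.Theorems.Prop7CombGauge (iterLin_add)
open Summit.QuantumFields.YangMills.BalabanUVNodes.N12FlatHierAxialRepr (iterLin_smul)
open Summit.QuantumFields.YangMills.BalabanUVNodes.N12FlatFibreNullSpace (exists_centreGauge_of_plaq_eq_zero_of_iterLin_eq_zero)
open B15DeterminingSets (embIter)
open Node00 (coeField)

namespace Summit.QuantumFields.YangMills.Theorems.FluctuationComparisonRegPrIntLS2BetaFlatFibreTangent

/-! ## §1 A calculus letter: an `O(t²)`-flat function has zero derivative at `0` -/

/-- If `g` has derivative `D` at `0`, `g 0 = 0`, and `‖g t‖ ≤ C·t²` near `0`, then `D = 0`. [folklore] -/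
theorem deriv_eq_zero_of_norm_le_sq {E : Type*} [NormedAddCommGroup E] [NormedSpace ℝ E] {g : ℝ → E} {D : E}
    (hg : HasDerivAt g D 0) (hg0 : g 0 = 0) {C : ℝ} (hb : ∀ᶠ t in 𝓝 (0 : ℝ), ‖g t‖ ≤ C * t ^ 2) : D = 0 := by
  have h1 : Tendsto (fun t : ℝ => t⁻¹ • (g (0 + t) - g 0)) (𝓝[≠] 0) (𝓝 D) := hasDerivAt_iff_tendsto_slope_zero.1 hg
  simp only [zero_add, hg0, sub_zero] at h1
  -- the slope is bounded by `|C|·|t|`, hence tends to `0`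
  have h2 : Tendsto (fun t : ℝ => t⁻¹ • g t) (𝓝[≠] 0) (𝓝 0) := by
    have hb' : ∀ᶠ t in 𝓝[≠] (0 : ℝ), ‖t⁻¹ • g t‖ ≤ |C| * |t| := by
      filter_upwards [nhdsWithin_le_nhds hb, self_mem_nhdsWithin] with t ht hne
      rw [norm_smul, norm_inv, Real.norm_eq_abs]
      have ht0 : 0 < |t| := abs_pos.2 hne
      calc |t|⁻¹ * ‖g t‖ ≤ |t|⁻¹ * (|C| * t ^ 2) := by
            gcongr
            exact ht.trans (mul_le_mul_of_nonneg_right (le_abs_self C) (sq_nonneg t))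
        _ = |C| * |t| := by rw [← sq_abs]; field_simp
    have h0 : Tendsto (fun t : ℝ => |C| * |t|) (𝓝[≠] 0) (𝓝 0) := by
      have : Tendsto (fun t : ℝ => |C| * |t|) (𝓝 0) (𝓝 (|C| * |0|)) :=
        tendsto_const_nhds.mul (continuous_abs.tendsto 0)
      rw [abs_zero, mul_zero] at this
      exact this.mono_left nhdsWithin_le_nhds
    exact squeeze_zero_norm' hb' h0
  exact tendsto_nhds_unique h1 h2

/-! ## §2 The flat fibre tangent -/

section Tangent

variable {N : Type*} [Fintype N] [DecidableEq N] [Nonempty N]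
variable (F : T3Family) {n K : ℕ} (h : n ≤ K)

/-- ★★ **THE VELOCITY AT `1` OF A DIFFERENTIABLE CURVE INSIDE THE FLAT FIBRE OF THE `(K−n)`-FOLD AVERAGE OF RECORD LIES IN THE KERNEL OF THE
LINEARISED AVERAGE.**  For any recursion family `Q^{(·)}` of `linAvg`, any curve `γ` of `SU(N)` fields on run `K`'s finest lattice whose matrix entries are
differentiable at `t = 0` with velocity `Z`, `γ 0 = 1`, and `D_{n,K}(γ t) = 1` for `t` near `0`: `Q^{(K−n)} Z = 0` on every bond of height `K − n`.
Mechanism: the C^{1,1} expansion of `D_{n,K}` at the flat field (✓`Prop7DescendJunction.norm_descendTo_sub_one_le_and_sub_lin_le`, [Balaban1985Averaging] Prop. 4) gives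
`‖Q^{(K−n)}(γ t − 1)(c)‖ ≤ C·t²` along the curve; `t ↦ Q^{(K−n)}(γ t − 1)(c)` is linear in `γ t − 1` (✓`iterLin_add`, ✓`iterLin_smul`), so its derivative `Q^{(K−n)}Z(c)`
vanishes (§1).  [cite: Balaban1985Averaging, Prop. 4 (134)-(135) p.38; Balaban1987RG1, (0.4) p.253] -/
theorem iterLin_eq_zero_of_hasDerivAt_of_descendTo_eq_one
    (Q : (i : ℕ) → (PBond (F.P K) 0 → Matrix N N ℂ) → PBond (F.P K) i → Matrix N N ℂ)
    (hQ0 : ∀ Y, Q 0 Y = Y)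
    (hQs : ∀ (i : ℕ) (Y : PBond (F.P K) 0 → Matrix N N ℂ) (c : PBond (F.P K) (i + 1)), Q (i + 1) Y c = linAvg (Q i Y) c)
    {γ : ℝ → GaugeField (F.P K) 0 (Matrix.specialUnitaryGroup N ℂ)} {Z : PBond (F.P K) 0 → Matrix N N ℂ}
    (hγ : HasDerivAt (fun t => fun b => ((γ t b : Matrix.specialUnitaryGroup N ℂ) : Matrix N N ℂ)) Z 0) (hγ0 : γ 0 = 1)
    (hfib : ∀ᶠ t in 𝓝 (0 : ℝ), descendTo F (expMeanLogSU (n := N)) n K h (γ t) = 1) :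
    ∀ c : PBond (F.P K) (K - n), Q (K - n) Z c = 0 := by
  intro c
  -- the coarse bond as the image of a bond of run `n`'s finest lattice
  set e := bondShift (F.sitesPerDir_eq (m := F.m) (K := n) (j := 0) (m' := F.m) (K' := K) (j' := K - n) (by have := F.hm; omega)) with he
  obtain ⟨b, rfl⟩ : ∃ b, e b = c := ⟨e.symm c, e.apply_symm_apply c⟩
  -- the matrix-valued curve and its deviation from `1`
  set f : ℝ → PBond (F.P K) 0 → Matrix N N ℂ := fun t => fun b => ((γ t b : Matrix.specialUnitaryGroup N ℂ) : Matrix N N ℂ) with hf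
  have hf0 : f 0 = 1 := by
    funext b'
    simp only [hf, hγ0]
    rfl
  -- `Y ↦ Q^{(K−n)} Y (e b)` as a continuous real-linear map
  let Lc : (PBond (F.P K) 0 → Matrix N N ℂ) →ₗ[ℝ] Matrix N N ℂ :=
    { toFun := fun Y => Q (K - n) Y (e b)
      map_add' := fun Y Y' => iterLin_add Q hQ0 hQs Y Y' (K - n) (e b)
      map_smul' := fun r Y => by
        have hr : r • Y = fun b' => (r : ℂ) • Y b' := funext fun b' => RCLike.real_smul_eq_coe_smul (K := ℂ) r (Y b')
        rw [hr, iterLin_smul Q hQ0 hQs, RingHom.id_apply]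
        exact (RCLike.real_smul_eq_coe_smul (K := ℂ) r _).symm }
  let L : (PBond (F.P K) 0 → Matrix N N ℂ) →L[ℝ] Matrix N N ℂ := LinearMap.toContinuousLinearMap Lc
  have hL : ∀ Y, L Y = Q (K - n) Y (e b) := fun Y => rfl
  -- `g t := Q^{(K−n)}(γ t − 1)(e b)` has derivative `Q^{(K−n)} Z (e b)` at `0` and vanishes at `0`
  have hg : HasDerivAt (fun t => L (f t - 1)) (L Z) 0 := L.hasFDerivAt.comp_hasDerivAt 0 (hγ.sub_const 1)
  have hg0 : (fun t => L (f t - 1)) 0 = 0 := by simp only [hf0, sub_self, map_zero]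
  -- the deviation `δ(t) = ‖γ t − 1‖` is `O(t)`
  obtain ⟨M, hM⟩ := (hγ.isBigO_sub).bound
  have hMf : ∀ᶠ t in 𝓝 (0 : ℝ), ‖f t - 1‖ ≤ M * ‖t‖ := by
    simpa only [sub_zero, hf0] using hM
  -- the three smallness rows of the C^{1,1} letter hold near `t = 0`
  have hcont : Tendsto (fun t => ‖f t - 1‖) (𝓝 0) (𝓝 0) := by
    have h1 : Tendsto f (𝓝 0) (𝓝 (f 0)) := hγ.continuousAt
    have h2 : Tendsto (fun t => f t - 1) (𝓝 0) (𝓝 (f 0 - 1)) := h1.sub tendsto_const_nhds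
    rw [hf0, sub_self] at h2
    exact tendsto_norm_zero.comp h2
  set A : ℝ := (((F.P K).d : ℝ) + 1) * ((F.P K).L : ℝ) ^ (K - n) with hA
  set C₁ : ℝ := ((((F.P K).d : ℝ) + 1) * ((18 : ℝ) ^ (F.P K).d * (2 + (((F.P K).d : ℝ) + 1) * (18 : ℝ) ^ (F.P K).d)) *
        (324 * ((((F.P K).d + 2) * (F.P K).L : ℕ) : ℝ) ^ 2) / (((F.P K).L : ℝ) * (((F.P K).L : ℝ) - 1))) with hC₁
  set ℓ : ℝ := ((((F.P K).d + 2) * (F.P K).L : ℕ) : ℝ) with hℓ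
  have hsmall : ∀ᶠ t in 𝓝 (0 : ℝ), C₁ * (A * ‖f t - 1‖) ≤ 1 ∧ 32 * ℓ * (A * ‖f t - 1‖) ≤ 1 ∧ 4 * ℓ * (A * ‖f t - 1‖) < deltaSU N := by
    have hδ := deltaSU_pos (n := N)
    have t1 : Tendsto (fun t => C₁ * (A * ‖f t - 1‖)) (𝓝 0) (𝓝 0) := by
      simpa using (hcont.const_mul A).const_mul C₁
    have t2 : Tendsto (fun t => 32 * ℓ * (A * ‖f t - 1‖)) (𝓝 0) (𝓝 0) := by
      simpa using (hcont.const_mul A).const_mul (32 * ℓ)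
    have t3 : Tendsto (fun t => 4 * ℓ * (A * ‖f t - 1‖)) (𝓝 0) (𝓝 0) := by
      simpa using (hcont.const_mul A).const_mul (4 * ℓ)
    filter_upwards [t1.eventually (eventually_le_nhds zero_lt_one), t2.eventually (eventually_le_nhds zero_lt_one),
      t3.eventually (eventually_lt_nhds hδ)] with t h1 h2 h3
    exact ⟨h1, h2, h3⟩
  -- the quadratic flatness of `g`
  have hflat : ∀ᶠ t in 𝓝 (0 : ℝ), ‖L (f t - 1)‖ ≤ (C₁ * (A * M) ^ 2) * t ^ 2 := by
    filter_upwards [hsmall, hfib, hMf] with t ht hft hMt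
    obtain ⟨h1, h2, h3⟩ := ht
    have hlem := (norm_descendTo_sub_one_le_and_sub_lin_le F h Q hQ0 hQs (γ t) (norm_nonneg (f t - 1))
      (fun b' => norm_le_pi_norm (f t - 1) b') h1 h2 h3 b).2
    rw [hft] at hlem
    have h1b : (((1 : GaugeField (F.P n) 0 (Matrix.specialUnitaryGroup N ℂ)) b : Matrix.specialUnitaryGroup N ℂ) : Matrix N N ℂ) - 1 = 0 := by
      rw [sub_eq_zero]; rfl
    rw [h1b, zero_sub, norm_neg] at hlem
    rw [hL]
    calc ‖Q (K - n) (f t - 1) (e b)‖ ≤ C₁ * (A * ‖f t - 1‖) ^ 2 := hlem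
      _ ≤ C₁ * (A * (M * ‖t‖)) ^ 2 := by
          have hC₁0 : 0 ≤ C₁ := by
            have hL1 : (1 : ℝ) < (F.P K).L := by exact_mod_cast (F.P K).hL.2
            rw [hC₁]; positivity
          have hA0 : 0 ≤ A := by rw [hA]; positivity
          gcongr
      _ = (C₁ * (A * M) ^ 2) * t ^ 2 := by rw [Real.norm_eq_abs, show t ^ 2 = |t| ^ 2 from (sq_abs t).symm]; ring
  have hD := deriv_eq_zero_of_norm_le_sq hg hg0 hflat
  rwa [hL] at hD


/-- ★★ **CHART FORM** (the shape the (T)-chain consumes): for a family `Ψ : Y → fields` from a normed space with `Ψ 0 = 1`, matrix entries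
Fréchet-differentiable at `0` with differential `Ψ′`, and `D_{n,K}(Ψ y) = 1` for `y` near `0`, every directional velocity `Ψ′ y` lies in the kernel of
the linearised average: `Q^{(K−n)}(Ψ′ y) = 0` on every height-`(K−n)` bond.  [cite: Balaban1985Averaging, Prop. 4 (134)-(135) p.38; Balaban1987RG1, (0.4) p.253] -/
theorem iterLin_fderiv_eq_zero_of_descendTo_eq_one
    (Q : (i : ℕ) → (PBond (F.P K) 0 → Matrix N N ℂ) → PBond (F.P K) i → Matrix N N ℂ)
    (hQ0 : ∀ Y, Q 0 Y = Y)
    (hQs : ∀ (i : ℕ) (Y : PBond (F.P K) 0 → Matrix N N ℂ) (c : PBond (F.P K) (i + 1)), Q (i + 1) Y c = linAvg (Q i Y) c)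
    {Y : Type*} [NormedAddCommGroup Y] [NormedSpace ℝ Y]
    {Ψ : Y → GaugeField (F.P K) 0 (Matrix.specialUnitaryGroup N ℂ)} {Ψ' : Y →L[ℝ] (PBond (F.P K) 0 → Matrix N N ℂ)}
    (hΨ : HasFDerivAt (fun y => fun b => ((Ψ y b : Matrix.specialUnitaryGroup N ℂ) : Matrix N N ℂ)) Ψ' 0) (hΨ0 : Ψ 0 = 1)
    (hfib : ∀ᶠ y in 𝓝 (0 : Y), descendTo F (expMeanLogSU (n := N)) n K h (Ψ y) = 1) (y : Y) :
    ∀ c : PBond (F.P K) (K - n), Q (K - n) (Ψ' y) c = 0 := by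
  -- restrict to the line `t ↦ t • y`
  have hline : HasDerivAt (fun t : ℝ => t • y) y 0 := by
    simpa using (hasDerivAt_id (0 : ℝ)).smul_const y
  have hγ : HasDerivAt (fun t : ℝ => fun b => ((Ψ (t • y) b : Matrix.specialUnitaryGroup N ℂ) : Matrix N N ℂ)) (Ψ' y) 0 := by
    have h0 : (0 : Y) = (0 : ℝ) • y := (zero_smul ℝ y).symm
    exact hΨ.comp_hasDerivAt_of_eq (0 : ℝ) hline h0
  have hγ0 : Ψ ((0 : ℝ) • y) = 1 := by rw [zero_smul]; exact hΨ0
  have hfib' : ∀ᶠ t in 𝓝 (0 : ℝ), descendTo F (expMeanLogSU (n := N)) n K h (Ψ (t • y)) = 1 := by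
    have ht : Tendsto (fun t : ℝ => t • y) (𝓝 0) (𝓝 0) := by
      simpa using hline.continuousAt.tendsto
    exact ht.eventually hfib
  exact iterLin_eq_zero_of_hasDerivAt_of_descendTo_eq_one F h Q hQ0 hQs (γ := fun t => Ψ (t • y)) hγ hγ0 hfib'

end Tangent

/-! ## §3 HESS∘ at the flat datum from three letters -/

section Flat

variable {N : ℕ} [NeZero N]
variable (F : T3Family) {n K : ℕ} (h : n ≤ K)

/-- ★★ **HESS∘ AT THE FLAT DATUM, MODULO THE CHART'S TRANSVERSALITY AND THE SECOND-ORDER CHAIN RULE.**  Let `Ψ : Y → fields` be a chart through `1`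
(`Ψ 0 = 1`, `coeField ∘ Ψ` differentiable at `0` with differential `Ψ′`) inside the flat fibre (`D_{n,K}(Ψ y) = 1` near `0`), TRANSVERSAL to the
centre-vanishing pure gauges and injective at first order (`hT`: `Ψ′ y = dφ` with `φ` vanishing at the `(K−n)`-fold centres forces `y = 0`), and suppose the
second derivative of the Wilson action along `Ψ` is a positive multiple of the flat curl energy of the velocity (`hCR`, the chain rule at the critical point
`1`: lit ✓`Node00.deriv_deriv_wilsonAction4_expChart_one_eq_norm_sq`).  Then the (T)-chain's HESS∘ letter holds at `(V ≡ 1, U₀ ≡ 1)`: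
`0 < D²(A∘Ψ)(0)(y,y)` for `y ≠ 0` — by §2 the velocity is in `ker Q^{(K−n)}`, and a curl-free vector there is a centre-vanishing gradient
(✓`N12FlatFibreNullSpace.exists_centreGauge_of_plaq_eq_zero_of_iterLin_eq_zero`), which `hT` excludes.
[cite: Balaban1985Variational, (142) p.299, Sect. E p.300; Balaban1989LargeFieldII, (1.9) p.358] -/
theorem hessPos_flat_of_transversal_of_chainRule
    (Q : (i : ℕ) → (PBond (F.P K) 0 → Matrix (Fin N) (Fin N) ℂ) → PBond (F.P K) i → Matrix (Fin N) (Fin N) ℂ)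
    (hQ0 : ∀ Y, Q 0 Y = Y)
    (hQs : ∀ (i : ℕ) (Y : PBond (F.P K) 0 → Matrix (Fin N) (Fin N) ℂ) (c : PBond (F.P K) (i + 1)), Q (i + 1) Y c = linAvg (Q i Y) c)
    {Y : Type*} [NormedAddCommGroup Y] [NormedSpace ℝ Y]
    {Ψ : Y → GaugeField (F.P K) 0 (Matrix.specialUnitaryGroup (Fin N) ℂ)} {Ψ' : Y →L[ℝ] (PBond (F.P K) 0 → Matrix (Fin N) (Fin N) ℂ)}
    (hΨ : HasFDerivAt (fun y => coeField (Ψ y)) Ψ' 0) (hΨ0 : Ψ 0 = 1)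
    (hfib : ∀ᶠ y in 𝓝 (0 : Y), descendTo F (expMeanLogSU (n := Fin N)) n K h (Ψ y) = 1)
    (hT : ∀ (φ : Site (F.P K) 0 → Matrix (Fin N) (Fin N) ℂ), (∀ x : Site (F.P K) (K - n), φ (embIter (K - n) x) = 0) →
      ∀ y : Y, (∀ b : PBond (F.P K) 0, Ψ' y b = φ b.tgt - φ b.src) → y = 0)
    {κ : ℝ} (hκ : 0 < κ)
    (hCR : ∀ y : Y, fderiv ℝ (fderiv ℝ (fun y => wilsonAction4 (Ψ y))) 0 y y =
      κ * ∑ p : Plaq (F.P K) 0, ‖Ψ' y ⟨p.src, p.μ⟩ + Ψ' y ⟨p.src.shift p.μ, p.ν⟩ - Ψ' y ⟨p.src.shift p.ν, p.μ⟩ - Ψ' y ⟨p.src, p.ν⟩‖ ^ 2) :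
    ∀ y : Y, y ≠ 0 → 0 < fderiv ℝ (fderiv ℝ (fun y => wilsonAction4 (Ψ y))) 0 y y := by
  intro y hy
  rw [hCR y]
  refine mul_pos hκ ?_
  -- if the curl energy vanished, the velocity would be a centre-vanishing gradient, excluded by transversality
  by_contra hle
  have hsum : ∑ p : Plaq (F.P K) 0, ‖Ψ' y ⟨p.src, p.μ⟩ + Ψ' y ⟨p.src.shift p.μ, p.ν⟩ - Ψ' y ⟨p.src.shift p.ν, p.μ⟩ - Ψ' y ⟨p.src, p.ν⟩‖ ^ 2 = 0 :=
    le_antisymm (not_lt.1 hle) (Finset.sum_nonneg fun p _ => sq_nonneg _)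
  have hcurl : ∀ p : Plaq (F.P K) 0,
      Ψ' y ⟨p.src, p.μ⟩ + Ψ' y ⟨p.src.shift p.μ, p.ν⟩ - Ψ' y ⟨p.src.shift p.ν, p.μ⟩ - Ψ' y ⟨p.src, p.ν⟩ = 0 := fun p => by
    have hp := (Finset.sum_eq_zero_iff_of_nonneg fun p _ => sq_nonneg _).1 hsum p (Finset.mem_univ p)
    exact norm_eq_zero.1 (pow_eq_zero_iff two_ne_zero |>.1 hp)
  have hQ := iterLin_fderiv_eq_zero_of_descendTo_eq_one F h Q hQ0 hQs (Ψ := Ψ) (Ψ' := Ψ') hΨ hΨ0 hfib y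
  obtain ⟨φ, hφ0, hφ⟩ := exists_centreGauge_of_plaq_eq_zero_of_iterLin_eq_zero Q hQ0 hQs (K - n) (Ψ' y) hcurl hQ
  exact hy (hT φ hφ0 y hφ)

end Flat

end Summit.QuantumFields.YangMills.Theorems.FluctuationComparisonRegPrIntLS2BetaFlatFibreTangent

end
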